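import Mathlib
import Summits.Schanuel.Schanuel.Theses.RigidCore
import Summits.Schanuel.Schanuel.Theorems.RigidCoreMinimalCounterexampleInAclCorankOne
import Summits.Schanuel.Schanuel.Theorems.RigidCoreMinimalCounterexampleInAclCorankGeTwoLogPart
import Summits.Schanuel.Schanuel.Theorems.RigidCoreMinimalCounterexampleInAclCorankGeTwoHitSetRingDefinable
import Summits.Schanuel.Schanuel.Theorems.RigidCoreMinimalCounterexampleInAclCosetLineSparsityCurve
import Summits.Schanuel.Schanuel.Theorems.RigidCoreMinimalCounterexampleInAclGenericSparsityOfFree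
import Summits.Schanuel.Schanuel.Theorems.RigidCoreMinimalCounterexampleInAclNoFullLineOfGenericSparsity

/-!
# (S*) and item 14744 MODULO GENERIC FREE COSET-LINE SPARSITY — crux stmt-Schanuel-0969 `RigidCore.MinimalCounterexampleInAcl`

Line `kernel-arithmetic-selection` (lead prover-line-stmt-Schanuel-0969-c16-0), `--supports stmt-Schanuel-0969`; registered stubs
`stub_crux_iff_residues_of_genericSparsity` and `stub_geThree_iff_relResidue_of_genericSparsity` of the gen-35 skeleton
(`Cruxes/MinimalCounterexampleInAcl/Lines/kernel_arithmetic_selection.lean`).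

Gen-35 sharpening of Theorems/…OfResidues: the open sparsity input is now FCS♮⁺ (`stub_genericCosetLineSparsity`) — free coset-line
sparsity for families all of ONE TYPE over a field of constants `K = ℚ(ev)` and of transcendence degree EXACTLY `#T ≥ 2` over `K`
(what first failures produce), weaker than gen 31's FCS⁺ (`stub_genericSparsity_of_fcsPlus`); the curve case (transcendence degree ≤ 1, any
ambient dimension) is the tree theorem `stub_cosetLineSparsity_curve`, the abstract reduction to the K-generic dimension-drop form is
`stub_genericSparsity_of_free`, and the first-failure glue is `stub_noFullLine_of_genericSparsity`.  Hence S7b follows from FCS♮⁺ alone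
(`corankGeTwo_noFullLine_of_genericSparsity`), and:

THEOREMS: `stub_crux_iff_residues_of_genericSparsity` — FCS♮⁺ ⟹ ((S*) ⟺ R₃ ∧ S7′); `stub_geThree_iff_relResidue_of_genericSparsity` —
FCS♮⁺ ⟹ (item stmt-14744 `MinimalCounterexampleInAclGeThree` ⟺ S7′).  (R₃ = `stub_pureTwistedResidue`, S7′ = `stub_corankGeTwo_relResidue`,
both OPEN and NECESSARY for (S*).)

References: status note `Cruxes/MinimalCounterexampleInAcl/Lines/kernel_arithmetic_selection.md` §Addendum c16; [Kirby2010] J. Kirby,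
*Exponential algebraicity in exponential fields*, Bull. LMS 42 (2010), Prop. 7.2.
-/

noncomputable section

set_option linter.dupNamespace false

open Complex Set

namespace Summit.Schanuel.Schanuel.Cruxes.MinimalCounterexampleInAcl.KernelArithmeticSelection

open Summit.Schanuel.Schanuel.Theorems.AclSubsetLogFreeCore.Negative

/-- **S7b FROM FCS♮⁺** (curried): generic free coset-line sparsity in fibre dimension ≥ 2 gives "no full line of mates in a log direction
at corank ≥ 2", through the landed R3♮ ∘ R1♮ with the landed curve case. [cite: Kirby2010, Prop. 7.2] -/
theorem corankGeTwo_noFullLine_of_genericSparsity (hG : ∀ (ι : Type) [Fintype ι] (i₀ : ι) (c : ℂ) (J : Set ℤ) (q : ℤ → ι → ℂ) (Λ : Submodule ℤ (ι → ℤ)) (κ : Type) (ev : κ → ℂ) (j₀ : ℤ) (T : Finset (ι ⊕ ι)), j₀ ∈ J → 2 ≤ T.card → T.card + Module.finrank ℤ ↥Λ < Fintype.card ι → (∀ j ∈ J, LinearIndependent ℚ (q j) ∧ q j i₀ = c + 2 * ↑Real.pi * Complex.I * (j : ℂ)) → (∀ ω : ι → ℂ, Set.Finite {j : ℤ | j ∈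 J ∧ Complex.exp ∘ q j = ω}) → (∀ M ∈ Λ, ∀ j ∈ J, ∀ j' ∈ J, (∑ i, (M i : ℂ) * q j i) = ∑ i, (M i : ℂ) * q j' i) → (∀ j ∈ J, ∀ H : MvPolynomial (κ ⊕ (ι ⊕ ι)) ℚ, MvPolynomial.aeval (Sum.elim ev (Sum.elim (q j₀) (Complex.exp ∘ q j₀))) H = 0 ↔ MvPolynomial.aeval (Sum.elim ev (Sum.elim (q j) (Complex.exp ∘ q j))) H = 0) → AlgebraicIndependent ↥(IntermediateField.adjoin ℚ (Set.range ev)) (fun t : ↥T => Sum.elim (q j₀) (Complex.exp ∘ q j₀) (↑t : ι ⊕ ι)) → (∀ v : ι ⊕ ι, IsAlgebraic ↥(Algebra.adjoin ↥(IntermediateField.adjoin ℚ (Set.range ev)) ((Sum.elim (q j₀) (Complex.exp ∘ q j₀)) '' (↑T : Set (ι ⊕ ι)))) (Sum.elim (q j₀) (Complex.exp ∘ q j₀) v)) → (∀ J' ⊆ J, (∃ δ : ℝ, 0 < δ ∧ ∀ N₀ : ℕ, ∃ N : ℕ, N₀ ≤ N ∧ ∃ a : ℤ, δ * (N : ℝ)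 ≤ (Set.ncard {j : ℤ | j ∈ Finset.Ico a (a + (N : ℤ)) ∧ j ∈ J'} : ℝ)) → ∀ M : ι → ℤ, (∀ m : ℤ, m ≠ 0 → m • M ∉ Λ) → Set.Infinite ((fun j => ∑ i, (M i : ℂ) * q j i) '' J')) → ∀ δ : ℝ, 0 < δ → ∃ N₀ : ℕ, ∀ N : ℕ, N₀ ≤ N → ∀ a : ℤ, (Set.ncard {j : ℤ | j ∈ Finset.Ico a (a + (N : ℤ)) ∧ j ∈ J} : ℝ) < δ * (N : ℝ)) : ∀ (n r : ℕ), 3 ≤ n → r + 2 ≤ n → ∀ (x : Fin n → ℂ), x ∈ Summit.Schanuel.Schanuel.Cruxes.MinimalCounterexampleInAcl.KernelArithmeticSelection.firstFailures n → (∀ i : Fin n, (i : ℕ) < r → IsAlgebraic ℚ (Complex.exp (x i))) → (∀ M : Fin n → ℤ, (∃ i : Fin n, r ≤ (i : ℕ) ∧ M i ≠ 0) → Transcendental ℚ (Complex.exp (∑ i, (M i : ℂ) * x i))) → ∀ μ : Fin n → ℤ, (∀ i : Fin n, r ≤ (i : ℕ) → μ i = 0) → μ ≠ 0 → ∃ j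 : ℤ, ¬ ∃ x' ∈ Summit.Schanuel.Schanuel.Cruxes.MinimalCounterexampleInAcl.KernelArithmeticSelection.locusMates x, ∀ i : Fin n, (i : ℕ) < r → x' i = x i + 2 * ↑Real.pi * Complex.I * ((j • μ) i : ℂ) :=
  stub_noFullLine_of_genericSparsity (stub_genericSparsity_of_free hG stub_cosetLineSparsity_curve)

/-- **The corank ≥ 2 sector of (S*) from FCS♮⁺ and S7′** (S7a is the tree theorem `stub_corankGeTwo_hitSetRingDefinable`; composition
`corankGeTwo_of_pieces`). [cite: Kirby2010, Prop. 7.2] -/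
theorem corankGeTwo_of_genericSparsity_of_relResidue (hG : ∀ (ι : Type) [Fintype ι] (i₀ : ι) (c : ℂ) (J : Set ℤ) (q : ℤ → ι → ℂ) (Λ : Submodule ℤ (ι → ℤ)) (κ : Type) (ev : κ → ℂ) (j₀ : ℤ) (T : Finset (ι ⊕ ι)), j₀ ∈ J → 2 ≤ T.card → T.card + Module.finrank ℤ ↥Λ < Fintype.card ι → (∀ j ∈ J, LinearIndependent ℚ (q j) ∧ q j i₀ = c + 2 * ↑Real.pi * Complex.I * (j : ℂ)) → (∀ ω : ι → ℂ, Set.Finite {j : ℤ | j ∈ J ∧ Complex.exp ∘ q j = ω}) → (∀ M ∈ Λ, ∀ j ∈ J, ∀ j' ∈ J, (∑ i, (M i : ℂ) * q j i) = ∑ i, (M i : ℂ) * q j' i) → (∀ j ∈ J, ∀ H : MvPolynomial (κ ⊕ (ι ⊕ ι)) ℚ, MvPolynomial.aeval (Sum.elim ev (Sum.elim (q j₀) (Complex.exp ∘ q j₀))) H = 0 ↔ MvPolynomial.aeval (Sum.elim ev (Sum.elim (q j) (Complex.exp ∘ q j))) H = 0) → AlgebraicIndependent ↥(IntermediateField.adjoin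 ℚ (Set.range ev)) (fun t : ↥T => Sum.elim (q j₀) (Complex.exp ∘ q j₀) (↑t : ι ⊕ ι)) → (∀ v : ι ⊕ ι, IsAlgebraic ↥(Algebra.adjoin ↥(IntermediateField.adjoin ℚ (Set.range ev)) ((Sum.elim (q j₀) (Complex.exp ∘ q j₀)) '' (↑T : Set (ι ⊕ ι)))) (Sum.elim (q j₀) (Complex.exp ∘ q j₀) v)) → (∀ J' ⊆ J, (∃ δ : ℝ, 0 < δ ∧ ∀ N₀ : ℕ, ∃ N : ℕ, N₀ ≤ N ∧ ∃ a : ℤ, δ * (N : ℝ) ≤ (Set.ncard {j : ℤ | j ∈ Finset.Ico a (a + (N : ℤ)) ∧ j ∈ J'} : ℝ)) → ∀ M : ι → ℤ, (∀ m : ℤ, m ≠ 0 → m • M ∉ Λ) → Set.Infinite ((fun j => ∑ i, (M i : ℂ) * q j i) '' J')) → ∀ δ : ℝ, 0 < δ → ∃ N₀ : ℕ, ∀ N : ℕ, N₀ ≤ N → ∀ a : ℤ, (Set.ncard {j : ℤ | j ∈ Finset.Ico a (a + (N : ℤ)) ∧ j ∈ J} : ℝ) < δ * (N : ℝ)) (hS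 : ∀ (n r : ℕ), 3 ≤ n → r + 2 ≤ n → ∀ (x : Fin n → ℂ), x ∈ Summit.Schanuel.Schanuel.Cruxes.MinimalCounterexampleInAcl.KernelArithmeticSelection.firstFailures n → (∀ i : Fin n, (i : ℕ) < r → IsAlgebraic ℚ (Complex.exp (x i))) → (∀ M : Fin n → ℤ, (∃ i : Fin n, r ≤ (i : ℕ) ∧ M i ≠ 0) → Transcendental ℚ (Complex.exp (∑ i, (M i : ℂ) * x i))) → (∀ i : Fin n, (i : ℕ) < r → x i ∈ Summit.Schanuel.Schanuel.Theorems.AclSubsetLogFreeCore.Negative.expAcl) → ∀ i, x i ∈ Summit.Schanuel.Schanuel.Theorems.AclSubsetLogFreeCore.Negative.expAcl) : ∀ (n r : ℕ), 3 ≤ n → r + 2 ≤ n → ∀ (x : Fin n → ℂ), x ∈ Summit.Schanuel.Schanuel.Cruxes.MinimalCounterexampleInAcl.KernelArithmeticSelection.firstFailures n → (∀ i : Fin n, (i : ℕ) < r → IsAlgebraic ℚ (Complex.exp (x i))) → (∀ M : Fin n → ℤ, (∃ i : Fin n, r ≤ (i : ℕ) ∧ M i ≠ 0) → Transcendental ℚ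 (Complex.exp (∑ i, (M i : ℂ) * x i))) → ∀ i, x i ∈ Summit.Schanuel.Schanuel.Theorems.AclSubsetLogFreeCore.Negative.expAcl :=
  corankGeTwo_of_pieces
    (fun n r hn hr x hx halg hpure =>
      @stub_corankGeTwo_hitSetRingDefinable n r hn hr x hx halg hpure (FirstOrder.Ring.compatibleRingOfRing ℤ))
    (corankGeTwo_noFullLine_of_genericSparsity hG) hS

/-- **Registered stub — item stmt-14744 ⟺ S7′ MODULO FCS♮⁺ (PROVED).** [cite: Kirby2010, Prop. 7.2] -/
theorem stub_geThree_iff_relResidue_of_genericSparsity : (∀ (ι : Type) [Fintype ι] (i₀ : ι) (c : ℂ) (J : Set ℤ) (q : ℤ → ι → ℂ) (Λ : Submodule ℤ (ι → ℤ)) (κ : Type) (ev : κ → ℂ) (j₀ : ℤ) (T : Finset (ι ⊕ ι)), j₀ ∈ J → 2 ≤ T.card → T.card + Module.finrank ℤ ↥Λ < Fintype.card ι → (∀ j ∈ J, LinearIndependent ℚ (q j) ∧ q j i₀ = c + 2 * ↑Real.pi * Complex.I * (j : ℂ)) → (∀ ω : ι → ℂ, Set.Finite {j : ℤ | j ∈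 J ∧ Complex.exp ∘ q j = ω}) → (∀ M ∈ Λ, ∀ j ∈ J, ∀ j' ∈ J, (∑ i, (M i : ℂ) * q j i) = ∑ i, (M i : ℂ) * q j' i) → (∀ j ∈ J, ∀ H : MvPolynomial (κ ⊕ (ι ⊕ ι)) ℚ, MvPolynomial.aeval (Sum.elim ev (Sum.elim (q j₀) (Complex.exp ∘ q j₀))) H = 0 ↔ MvPolynomial.aeval (Sum.elim ev (Sum.elim (q j) (Complex.exp ∘ q j))) H = 0) → AlgebraicIndependent ↥(IntermediateField.adjoin ℚ (Set.range ev)) (fun t : ↥T => Sum.elim (q j₀) (Complex.exp ∘ q j₀) (↑t : ι ⊕ ι)) → (∀ v : ι ⊕ ι, IsAlgebraic ↥(Algebra.adjoin ↥(IntermediateField.adjoin ℚ (Set.range ev)) ((Sum.elim (q j₀) (Complex.exp ∘ q j₀)) '' (↑T : Set (ι ⊕ ι)))) (Sum.elim (q j₀) (Complex.exp ∘ q j₀) v)) → (∀ J' ⊆ J, (∃ δ : ℝ, 0 < δ ∧ ∀ N₀ : ℕ, ∃ N : ℕ, N₀ ≤ N ∧ ∃ a : ℤ, δ * (N : ℝ)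 ≤ (Set.ncard {j : ℤ | j ∈ Finset.Ico a (a + (N : ℤ)) ∧ j ∈ J'} : ℝ)) → ∀ M : ι → ℤ, (∀ m : ℤ, m ≠ 0 → m • M ∉ Λ) → Set.Infinite ((fun j => ∑ i, (M i : ℂ) * q j i) '' J')) → ∀ δ : ℝ, 0 < δ → ∃ N₀ : ℕ, ∀ N : ℕ, N₀ ≤ N → ∀ a : ℤ, (Set.ncard {j : ℤ | j ∈ Finset.Ico a (a + (N : ℤ)) ∧ j ∈ J} : ℝ) < δ * (N : ℝ)) → (Summit.Schanuel.Schanuel.Theses.RigidCore.MinimalCounterexampleInAclGeThree ↔ (∀ (n r : ℕ), 3 ≤ n → r + 2 ≤ n → ∀ (x : Fin n → ℂ), x ∈ Summit.Schanuel.Schanuel.Cruxes.MinimalCounterexampleInAcl.KernelArithmeticSelection.firstFailures n → (∀ i : Fin n, (i : ℕ) < r → IsAlgebraic ℚ (Complex.exp (x i))) → (∀ M : Fin n → ℤ, (∃ i : Fin n, r ≤ (i : ℕ) ∧ M i ≠ 0) → Transcendental ℚ (Complex.exp (∑ i, (M i : ℂ) * x i))) → (∀ i : Fin n, (i : ℕ)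 < r → x i ∈ Summit.Schanuel.Schanuel.Theorems.AclSubsetLogFreeCore.Negative.expAcl) → ∀ i, x i ∈ Summit.Schanuel.Schanuel.Theorems.AclSubsetLogFreeCore.Negative.expAcl)) := by
  intro hG
  constructor
  · intro h n _ hn _ x hx _ _ _ i
    exact h n hn x hx.1 hx.2.1 hx.2.2 i
  · intro hS
    exact geThree_iff_corankGeTwo.2 (corankGeTwo_of_genericSparsity_of_relResidue hG hS)

/-- **Registered stub — (S*) ⟺ R₃ ∧ S7′ MODULO FCS♮⁺ (PROVED).** [cite: Kirby2010, Prop. 7.2] -/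
theorem stub_crux_iff_residues_of_genericSparsity : (∀ (ι : Type) [Fintype ι] (i₀ : ι) (c : ℂ) (J : Set ℤ) (q : ℤ → ι → ℂ) (Λ : Submodule ℤ (ι → ℤ)) (κ : Type) (ev : κ → ℂ) (j₀ : ℤ) (T : Finset (ι ⊕ ι)), j₀ ∈ J → 2 ≤ T.card → T.card + Module.finrank ℤ ↥Λ < Fintype.card ι → (∀ j ∈ J, LinearIndependent ℚ (q j) ∧ q j i₀ = c + 2 * ↑Real.pi * Complex.I * (j : ℂ)) → (∀ ω : ι → ℂ, Set.Finite {j : ℤ | j ∈ J ∧ Complex.exp ∘ q j = ω}) → (∀ M ∈ Λ, ∀ j ∈ J, ∀ j' ∈ J, (∑ i, (M i : ℂ) * q j i) = ∑ i, (M i : ℂ) * q j' i) → (∀ j ∈ J, ∀ H : MvPolynomial (κ ⊕ (ι ⊕ ι)) ℚ, MvPolynomial.aeval (Sum.elim ev (Sum.elim (q j₀) (Complex.exp ∘ q j₀))) H = 0 ↔ MvPolynomial.aeval (Sum.elim ev (Sum.elim (q j) (Complex.exp ∘ q j))) H = 0) → AlgebraicIndependent ↥(IntermediateField.adjoin ℚ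 (Set.range ev)) (fun t : ↥T => Sum.elim (q j₀) (Complex.exp ∘ q j₀) (↑t : ι ⊕ ι)) → (∀ v : ι ⊕ ι, IsAlgebraic ↥(Algebra.adjoin ↥(IntermediateField.adjoin ℚ (Set.range ev)) ((Sum.elim (q j₀) (Complex.exp ∘ q j₀)) '' (↑T : Set (ι ⊕ ι)))) (Sum.elim (q j₀) (Complex.exp ∘ q j₀) v)) → (∀ J' ⊆ J, (∃ δ : ℝ, 0 < δ ∧ ∀ N₀ : ℕ, ∃ N : ℕ, N₀ ≤ N ∧ ∃ a : ℤ, δ * (N : ℝ) ≤ (Set.ncard {j : ℤ | j ∈ Finset.Ico a (a + (N : ℤ)) ∧ j ∈ J'} : ℝ)) → ∀ M : ι → ℤ, (∀ m : ℤ, m ≠ 0 → m • M ∉ Λ) → Set.Infinite ((fun j => ∑ i, (M i : ℂ) * q j i) '' J')) → ∀ δ : ℝ, 0 < δ → ∃ N₀ : ℕ, ∀ N : ℕ, N₀ ≤ N → ∀ a : ℤ, (Set.ncard {j : ℤ | j ∈ Finset.Ico a (a + (N : ℤ)) ∧ j ∈ J} : ℝ) < δ * (N : ℝ)) → (Summit.Schanuel.Schanuel.Theses.RigidCore.MinimalCounterexampleInAcl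 ↔ ((∀ (x : Fin 2 → ℂ), x ∈ Summit.Schanuel.Schanuel.Cruxes.MinimalCounterexampleInAcl.KernelArithmeticSelection.firstFailures 2 → (∀ M : Fin 2 → ℤ, M ≠ 0 → Transcendental ℚ (Complex.exp (∑ i, (M i : ℂ) * x i))) → Transcendental ↥(IntermediateField.adjoin ℚ (Set.range x ∪ Set.range (Complex.exp ∘ x))) (Complex.exp (x 0 ^ 2)) → Transcendental ↥(IntermediateField.adjoin ℚ (Set.range x ∪ Set.range (Complex.exp ∘ x))) (Complex.exp (x 0 * x 1)) → Transcendental ↥(IntermediateField.adjoin ℚ (Set.range x ∪ Set.range (Complex.exp ∘ x))) (Complex.exp (x 1 ^ 2)) → Transcendental ↥(IntermediateField.adjoin ℚ (Set.range x ∪ Set.range (Complex.exp ∘ x))) (Complex.exp (Complex.I * x 0)) → Transcendental ↥(IntermediateField.adjoin ℚ (Set.range x ∪ Set.range (Complex.exp ∘ x))) (Complex.exp (Complex.I * x 1)) → ∀ i, x i ∈ Summit.Schanuel.Schanuel.Theorems.AclSubsetLogFreeCore.Negative.expAcl) ∧ (∀ (n r : ℕ), 3 ≤ n → r + 2 ≤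 n → ∀ (x : Fin n → ℂ), x ∈ Summit.Schanuel.Schanuel.Cruxes.MinimalCounterexampleInAcl.KernelArithmeticSelection.firstFailures n → (∀ i : Fin n, (i : ℕ) < r → IsAlgebraic ℚ (Complex.exp (x i))) → (∀ M : Fin n → ℤ, (∃ i : Fin n, r ≤ (i : ℕ) ∧ M i ≠ 0) → Transcendental ℚ (Complex.exp (∑ i, (M i : ℂ) * x i))) → (∀ i : Fin n, (i : ℕ) < r → x i ∈ Summit.Schanuel.Schanuel.Theorems.AclSubsetLogFreeCore.Negative.expAcl) → ∀ i, x i ∈ Summit.Schanuel.Schanuel.Theorems.AclSubsetLogFreeCore.Negative.expAcl))) := by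
  intro hG
  constructor
  · intro h
    have h2 := crux_iff_pureTwistedResidue_and_corankGeTwo.1 h
    exact ⟨h2.1, fun n r hn hr x hx halg hpure _ => h2.2 n r hn hr x hx halg hpure⟩
  · rintro ⟨hR, hS⟩
    exact crux_of_pureTwistedResidue_of_corankGeTwo hR (corankGeTwo_of_genericSparsity_of_relResidue hG hS)

end Summit.Schanuel.Schanuel.Cruxes.MinimalCounterexampleInAcl.KernelArithmeticSelection

end
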